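import Literature.NumberTheory.LFunctions.Zhang2022.RepairBedDefectLadder
import Literature.NumberTheory.LFunctions.RealCharacterPartialSums
import Mathlib.Tactic.NormNum.LegendreSymbol

/-!
# Zhang (2022) rescue bed (D-0124 (3)), Negative lane: the (A)-defect exponent `aDefect` at a small modulus —
# `0.861 < aDefect (−3)`, from the kernel enclosure `L(1, χ₋₃) < 0.8`

Topic `Literature/NumberTheory/LFunctions/Zhang2022` (Landau–Siegel audit tree; verdict-neutral), cell landau-siegel,
LS RESCUE PROTOCOL (human ruling D-0124) part (3) «GENUINE BED», refuter lane (ls-rescue-ref-1). Y. Zhang, *Discrete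
mean estimates and the Landau–Siegel zero*, arXiv:2211.02515v1 (2022) [Zhang2022LandauSiegel] — an unrefereed
manuscript under adjudication. **Nothing here asserts or denies any of its claims; nothing here is a claim about
Landau–Siegel zeros. The programme SEARCHES and TYPES; no claim about Landau–Siegel zeros, Theorems 1–2 of
arXiv:2211.02515 or a repaired Margin232 until a kernel theorem says so.**

## What is here (negative knowledge about a bed sentence, kernel-checked)

The bed/gap books carried the sentence «a(D) = −log L(1,χ_D)/log log|D| ≤ 0.861 on all 88 moduli (max at D = −163)»
(rescue/BED.md §4.G G101, GAP-TABLE Part H; refuter ls-rescue-ref-2 R2-B63 observed that the engines print «n/a» at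
the ten moduli with `|D| < 16`, while the typed referent `Repair.Bed.aDefect` (`RepairBedDefectLadder`) is the
UNCLAMPED formula). This file makes the observation a theorem at the smallest modulus:

* `LOne_neg_three_lt` — `L(1, χ₋₃) < 0.8` (true value `π/(3√3) = 0.6046…`), from the tree's real-axis partial-sum bound
  `DirichletAbel.abs_re_LFunction_one_sub_sum_floor_le` (`|L(1,χ) − Σ_{n ≤ t} χ(n)/n| ≤ 2q/t`, MV §4.3) at `t = 30`
  with the thirty values `χ₋₃(n) = (n/3)` evaluated in the kernel;
* `LOne_neg_three_pos` — `0 < L(1, χ₋₃)`;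
* `one_lt_log_three`, `log_three_lt` — `1 < log 3 < 1.1037` (`exp 1` to nine digits, `log x ≤ x − 1`);
* `aDefect_neg_three_gt` — **`0.861 < aDefect (−3)`** (indeed `a(−3) = 5.35…`): the sentence as typed fails at
  `D = −3`; the book wording was repaired to «on the 78 bed moduli with |D| ≥ 16» (ls-rescue-lead g2 ruling (r),
  2026-08-27), and the decl stays unclamped by ruling (p) — this theorem records WHY the side condition is needed.

No `instance`, no new definition; `NeZero |−3|` is built in-term exactly as in `RepairBedModuli.LOne`.

## References

* H. L. Montgomery, R. C. Vaughan, *Multiplicative Number Theory I*, CUP 2007, §4.3 (4.23), Thm. 4.8 (partial sums of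
  `L(σ,χ)` on the real axis), §9.3 (quadratic characters). [cite: MontgomeryVaughan2007, §4.3 (4.23), Thm. 4.8; §9.3]
* Y. Zhang, arXiv:2211.02515v1 (2022), §2 Assumption (A) p. 4. [cite: Zhang2022LandauSiegel, §2 Assumption (A)]
-/

noncomputable section

open Complex Finset

namespace Literature.NumberTheory.LFunctions.Zhang2022.Repair.Bed

open Literature.NumberTheory.LFunctions.KroneckerCharacter
open Literature.NumberTheory.LFunctions.DirichletAbel

/-- `|−3| = 3` as natural numbers. [folklore] -/
private theorem natAbs_neg_three : (-3 : ℤ).natAbs = 3 := rfl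

/-- `NeZero |−3|`, in-term (not an instance). [folklore] -/
private theorem neZero_natAbs_neg_three : NeZero (-3 : ℤ).natAbs := ⟨by decide⟩

/-- The values of `χ₋₃`: `Re χ₋₃(n) = (n/3)` (Jacobi symbol) for `n ≥ 1` — `−3 ≡ 1 (mod 4)`, so `χ₋₃ = (·/3)`
(`kroneckerChar_of_odd`, `jacobiChar_natCast`). [folklore] -/
private theorem reChar_kroneckerChar_neg_three {n : ℕ} (hn : n ≠ 0) :
    haveI := neZero_natAbs_neg_three
    reChar (kroneckerChar (-3)) n = ((jacobiSym n 3 : ℤ) : ℝ) := by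
  haveI := neZero_natAbs_neg_three
  rw [reChar_apply _ hn, kroneckerChar_of_odd (by decide), jacobiChar_natCast, Complex.intCast_re, natAbs_neg_three]

/-- `χ₋₃ ≠ χ₀`: `χ₋₃(2) = (2/3) = −1`. [folklore] -/
private theorem kroneckerChar_neg_three_ne_one :
    haveI := neZero_natAbs_neg_three
    kroneckerChar (-3) ≠ 1 := by
  haveI := neZero_natAbs_neg_three
  apply ne_one_of_apply_eq_neg_one (a := ((2 : ℕ) : ZMod (-3 : ℤ).natAbs))
  rw [kroneckerChar_of_odd (by decide), jacobiChar_natCast, natAbs_neg_three]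
  have h : jacobiSym ((2 : ℕ) : ℤ) 3 = -1 := by norm_num
  rw [h]; push_cast; ring

/-- The thirty-term partial sum `Σ_{n=1}^{30} χ₋₃(n)/n ≤ 0.5935` (exact value `0.593497…`). [folklore] -/
private theorem partialSum_thirty_le :
    haveI := neZero_natAbs_neg_three
    ∑ n ∈ Ioc 0 30, reChar (kroneckerChar (-3)) n / n ≤ (0.5935 : ℝ) := by
  haveI := neZero_natAbs_neg_three
  rw [sum_Ioc_eq_sum_range_succ]
  rw [sum_congr rfl fun n _ => by rw [reChar_kroneckerChar_neg_three (Nat.succ_ne_zero n)]]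
  simp only [sum_range_succ, sum_range_zero]
  norm_num

/-- **`L(1, χ₋₃) < 0.8`** (true value `π/(3√3) = 0.60459…`): partial sum to `30` plus the tail bound `2·3/30`.
[cite: MontgomeryVaughan2007, §4.3 (4.23), Thm. 4.8] -/
theorem LOne_neg_three_lt : LOne (-3) < 0.8 := by
  haveI := neZero_natAbs_neg_three
  have hL : LOne (-3) = ((kroneckerChar (-3)).LFunction 1).re := by
    simp only [LOne, dif_neg (by norm_num : (-3 : ℤ) ≠ 0)]
  have h1 := kroneckerChar_neg_three_ne_one
  have hq : kroneckerChar (-3) ^ 2 = 1 := (isQuadratic_kroneckerChar (-3)).sq_eq_one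
  have htail := abs_re_LFunction_one_sub_sum_floor_le (kroneckerChar (-3)) h1 hq (t := 30) (by norm_num)
  have hfloor : ⌊(30 : ℝ)⌋₊ = 30 := Nat.floor_ofNat 30
  have hq3 : (((-3 : ℤ).natAbs : ℕ) : ℝ) = 3 := by rw [natAbs_neg_three]; norm_num
  rw [hfloor, hq3] at htail
  have hS := partialSum_thirty_le
  have hup := (abs_sub_le_iff.1 htail).1
  rw [hL]
  norm_num at hup ⊢
  linarith

/-- **`0 < L(1, χ₋₃)`** (`χ₋₃ ≠ χ₀`; tree `LFunction_one_pos_of_ne_one`). [cite: MontgomeryVaughan2007, §9.3] -/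
theorem LOne_neg_three_pos : 0 < LOne (-3) := by
  haveI := neZero_natAbs_neg_three
  have hL : LOne (-3) = ((kroneckerChar (-3)).LFunction 1).re := by
    simp only [LOne, dif_neg (by norm_num : (-3 : ℤ) ≠ 0)]
  rw [hL]
  exact (LFunction_one_pos_of_ne_one kroneckerChar_neg_three_ne_one).1

/-- `1 < log 3` (`exp 1 < 2.72 < 3`). [folklore] -/
private theorem one_lt_log_three : 1 < Real.log 3 := by
  rw [Real.lt_log_iff_exp_lt (by norm_num)]
  have := Real.exp_one_lt_d9
  linarith

/-- `log 3 < 1.1037` (`log 3 = 1 + log(3/e) ≤ 3/e < 3/2.7182818283`). [folklore] -/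
private theorem log_three_lt : Real.log 3 < 1.1037 := by
  have he : 0 < Real.exp 1 := Real.exp_pos 1
  have h1 : Real.log (3 / Real.exp 1) ≤ 3 / Real.exp 1 - 1 := Real.log_le_sub_one_of_pos (by positivity)
  rw [Real.log_div (by norm_num) he.ne', Real.log_exp] at h1
  have h2 : 3 / Real.exp 1 < 3 / 2.7182818283 := div_lt_div_of_pos_left (by norm_num) (by norm_num) Real.exp_one_gt_d9
  have h3 : (3 : ℝ) / 2.7182818283 < 1.1037 + 1 - 1 := by norm_num
  linarith

/-- **The bed sentence «a(D) ≤ 0.861 on all 88 moduli» FAILS AS TYPED at `D = −3`: `0.861 < aDefect (−3)`**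
(indeed `a(−3) = −log(π/(3√3))/log log 3 = 5.35…`). Kernel route: `−log L ≥ 1 − L > 0.2` (`LOne_neg_three_lt`) and
`0 < log log 3 ≤ log 3 − 1 < 0.1037`. The repaired wording restricts to the 78 bed moduli with `|D| ≥ 16`; the typed
`aDefect` is deliberately unclamped (lead rulings (p)/(r), 2026-08-27). [cite: Zhang2022LandauSiegel, §2 Assumption (A)] -/
theorem aDefect_neg_three_gt : 0.861 < aDefect (-3) := by
  have hL0 := LOne_neg_three_pos
  have hL1 := LOne_neg_three_lt
  have hlo := one_lt_log_three
  have hhi := log_three_lt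
  have habs : |((-3 : ℤ) : ℝ)| = 3 := by norm_num
  rw [aDefect, habs]
  have hM0 : 0 < Real.log (Real.log 3) := Real.log_pos hlo
  have hM1 : Real.log (Real.log 3) ≤ Real.log 3 - 1 := Real.log_le_sub_one_of_pos (by linarith)
  have hnum : 1 - LOne (-3) ≤ -Real.log (LOne (-3)) := by
    have := Real.log_le_sub_one_of_pos hL0
    linarith
  rw [lt_div_iff₀ hM0]
  nlinarith

end Literature.NumberTheory.LFunctions.Zhang2022.Repair.Bed
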